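import Summits.SmoothPoincare4.SmoothPoincare4.Theses.ZeroSurgeryExotic
import Literature.Topology.FourManifolds.ConnectedSumTransportProofs
import Literature.Topology.FourManifolds.OpenGluingIsManifold
import Literature.Topology.FourManifolds.DehnSurgeryUniquenessProofs
import Literature.Topology.FourManifolds.DehnSurgeryUnknotZeroProofs
import Literature.Topology.FourManifolds.DehnSurgeryProofs
import Literature.Topology.FourManifolds.SurgeryGluck
import Literature.Topology.FourManifolds.KnotsProofs
import Literature.Topology.FourManifolds.KnotsIsotopyProofs
import Literature.Topology.FourManifolds.KirbyMovesIsotopyProofs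
import Literature.Topology.FourManifolds.SliceRibbonIsotopyProofs

/-!
# `ZseThesis` — negative knowledge IV: the unknot cannot seed a witness (mod Gabai's Property R), via a cross-model transport of surgery descriptions

Refuter support lemmas for crux `stmt-SmoothPoincare4-0364` (`ZeroSurgeryExotic.ZseThesis`: knots `K, K'` with a
common `0`-surgery `Y`, `K` smoothly slice, `K'` not), from the standing disprover's work file
`Summits/SmoothPoincare4/SmoothPoincare4/Cruxes/ZseThesis/Disproof.lean` §3e.

* TRANSPORT ACROSS MODELS (new, unconditional; generalises `ConnectedSumTransportProofs.lean`, which keeps the model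
  vector space): for BOUNDARYLESS models `IP`, `IP'` on continuously-linearly isomorphic vector spaces
  `L : EP ≃L[ℝ] EP'`, a diffeomorphism `e : P ≃ₘ⟮IP, IP'⟯ P'` transports maximal-atlas charts
  (`exists_transportChart'`), immersions and smooth embeddings (`isSmoothEmbedding_diffeomorph_comp'`), open gluings
  (`isOpenGluing_diffeomorph_comp'`) and integral surgery descriptions (`isIntegralSurgery_diffeomorph_comp'`).
* `isUnknot_of_zeroSurgeryPair_unknot` — hence Property R in "friend form" over the crux's own `ℝ³`-charted `Y`
  FOLLOWS from the tree's named fact `isUnknot_of_isIntegralSurgery_zero` (Gabai 1987 Cor. 8.3, stated on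
  `S² × S¹` with its product model `ℝ² × ℝ¹`), through uniqueness of surgery (proved) and the transport — this also
  discharges the spelled-out hypothesis `PropertyRFriendForm` of the sibling crux ZseCruxRasmussen (§12 of its work
  file) down to Gabai's theorem.
* `zseThesis_unknotSeed_false_of_gabai`, `witness_seed_not_isUnknot_of_gabai` — mod Gabai, the unknot (or any
  unknotted `K`) seeds no witness: the slice knot of a witness is KNOTTED. `unknotPair_exists`: not vacuous.
No definitions; no route item is concluded positively.
References: Gabai, J. Differential Geom. 26 (1987) Cor. 8.3 [GabaiJDG1987]; Kosinski 1993 Ch. VI §1 and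
I.(1.1)–(1.2) [Kosinski1993]; Gompf–Stipsicz 1999 §5.3 [GompfStipsicz1999].
-/

noncomputable section

set_option linter.dupNamespace false

open scoped Manifold ContDiff Topology
open Function Set
open Literature.Topology.FourManifolds
open Summit.SmoothPoincare4.SmoothPoincare4.Theses.ZeroSurgeryExotic

namespace Summit.SmoothPoincare4.SmoothPoincare4.Theorems.ZseThesis.Negative


/-! ### Model homeomorphism for boundaryless models on isomorphic vector spaces -/

section ModelIso

variable {E E' H H' : Type*} [NormedAddCommGroup E] [NormedSpace ℝ E] [NormedAddCommGroup E']
  [NormedSpace ℝ E'] [TopologicalSpace H] [TopologicalSpace H'] {I : ModelWithCorners ℝ E H}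
  {I' : ModelWithCorners ℝ E' H'}

/-- Two BOUNDARYLESS models `I : H → E`, `I' : H' → E'` on continuously-linearly isomorphic vector spaces
(`L : E ≃L[ℝ] E'`) have homeomorphic model spaces via `I'.symm ∘ L ∘ I`, both directions `C^∞` (Kosinski,
*Differential Manifolds*, I.(1.1)–(1.2)). [cite: Kosinski1993, Ch. I (1.1)–(1.2)] -/
theorem exists_modelHomeomorph_of_boundaryless [I.Boundaryless] [I'.Boundaryless] (L : E ≃L[ℝ] E') :
    ∃ φ : H ≃ₜ H', ContMDiff I I' ∞ φ ∧ ContMDiff I' I ∞ φ.symm ∧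
      (∀ x, φ x = I'.symm (L (I x))) ∧ ∀ y, φ.symm y = I.symm (L.symm (I' y)) := by
  have hr : ∀ z : E', z ∈ range I' := fun z => by rw [I'.range_eq_univ]; exact mem_univ z
  have hr' : ∀ z : E, z ∈ range I := fun z => by rw [I.range_eq_univ]; exact mem_univ z
  let φ : H ≃ₜ H' :=
    { toFun := I'.symm ∘ L ∘ I
      invFun := I.symm ∘ L.symm ∘ I'
      left_inv := fun x => by
        simp only [Function.comp_apply]
        rw [I'.right_inv (hr _), L.symm_apply_apply, I.left_inv]
      right_inv := fun x => by
        simp only [Function.comp_apply]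
        rw [I.right_inv (hr' _), L.apply_symm_apply, I'.left_inv]
      continuous_toFun := I'.continuous_symm.comp (L.continuous.comp I.continuous)
      continuous_invFun := I.continuous_symm.comp (L.symm.continuous.comp I'.continuous) }
  refine ⟨φ, ?_, ?_, fun x => rfl, fun y => rfl⟩
  · have h1 : ContMDiffOn 𝓘(ℝ, E') I' ∞ I'.symm (range I') := I'.contMDiffOn_symm
    have h2 : ContMDiff I 𝓘(ℝ, E') ∞ (L ∘ I) := L.contDiff.contMDiff.comp I.contMDiff
    exact h1.comp_contMDiff h2 (fun x => hr _)
  · have h1 : ContMDiffOn 𝓘(ℝ, E) I ∞ I.symm (range I) := I.contMDiffOn_symm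
    have h2 : ContMDiff I' 𝓘(ℝ, E) ∞ (L.symm ∘ I') := L.symm.contDiff.contMDiff.comp I'.contMDiff
    exact h1.comp_contMDiff h2 (fun x => hr' _)

end ModelIso

/-! ### Transport of charts, immersions, embeddings, gluings across isomorphic models -/

universe u

section Transport

variable {EA HA HP HP' : Type*} {EP EP' : Type u}
  [NormedAddCommGroup EA] [NormedSpace ℝ EA] [TopologicalSpace HA] {IA : ModelWithCorners ℝ EA HA}
  [NormedAddCommGroup EP] [NormedSpace ℝ EP] [TopologicalSpace HP] {IP : ModelWithCorners ℝ EP HP}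
  [NormedAddCommGroup EP'] [NormedSpace ℝ EP'] [TopologicalSpace HP'] {IP' : ModelWithCorners ℝ EP' HP'}
  {A P P' : Type*} [TopologicalSpace A] [ChartedSpace HA A]
  [TopologicalSpace P] [ChartedSpace HP P] [TopologicalSpace P'] [ChartedSpace HP' P']

/-- **Transport of a chart along a diffeomorphism across isomorphic boundaryless models**: a chart of the maximal
`C^∞` atlas of `P` is carried by `e : P ≃ₘ⟮IP, IP'⟯ P'` to the chart `IP'.symm ∘ L ∘ IP ∘ ψ ∘ e.symm` of the maximal
`C^∞` atlas of `P'`. [cite: Kosinski1993, Ch. I (1.1)–(1.2)] -/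
theorem exists_transportChart' [IP.Boundaryless] [IP'.Boundaryless] [IsManifold IP' ∞ P']
    (L : EP ≃L[ℝ] EP') (e : P ≃ₘ⟮IP, IP'⟯ P')
    {ψ : OpenPartialHomeomorph P HP} (hψ : ψ ∈ IsManifold.maximalAtlas IP ∞ P) :
    ∃ χ : OpenPartialHomeomorph P' HP', χ ∈ IsManifold.maximalAtlas IP' ∞ P' ∧
      χ.source = e.symm ⁻¹' ψ.source ∧ ∀ x, χ x = IP'.symm (L (IP (ψ (e.symm x)))) := by
  obtain ⟨φ, hφ, hφs, hφx, -⟩ := exists_modelHomeomorph_of_boundaryless (I := IP) (I' := IP') L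
  refine ⟨(e.symm.toHomeomorph.transOpenPartialHomeomorph ψ).transHomeomorph φ, ?_, rfl,
    fun x => ?_⟩
  · apply OpenPartialHomeomorph.mem_maximalAtlas_of_contMDiffOn
    · have h1 : ContMDiffOn IP IP ∞ ψ ψ.source := contMDiffOn_of_mem_maximalAtlas hψ
      have h2 : ContMDiffOn IP' IP ∞ (ψ ∘ e.symm) (e.symm ⁻¹' ψ.source) :=
        h1.comp e.symm.contMDiff.contMDiffOn (fun x hx => hx)
      have h3 := hφ.comp_contMDiffOn h2
      exact h3.congr_mono (fun x _ => rfl) subset_rfl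
    · have h1 : ContMDiffOn IP IP ∞ ψ.symm ψ.target := contMDiffOn_symm_of_mem_maximalAtlas hψ
      have h2 : ContMDiffOn IP' IP ∞ (ψ.symm ∘ φ.symm) (φ.symm ⁻¹' ψ.target) :=
        h1.comp hφs.contMDiffOn (fun x hx => hx)
      have h3 := e.contMDiff.comp_contMDiffOn h2
      exact h3.congr_mono (fun x _ => rfl) subset_rfl
  · exact hφx _

/-- Post-composing a `C^∞` immersion at `a` (complement `F`) with a diffeomorphism onto a manifold modelled
(boundarylessly) on an isomorphic vector space is an immersion at `a`: keep the domain chart, compose the linear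
equivalence with `L`, transport the codomain chart. (Special case of Mathlib's TODO `IsImmersionAt.comp`.)
[cite: Kosinski1993, Ch. VI §1] -/
theorem isImmersionAtOfComplement_diffeomorph_comp' [IP.Boundaryless] [IP'.Boundaryless]
    [IsManifold IP' ∞ P'] (L : EP ≃L[ℝ] EP') {F : Type*}
    [NormedAddCommGroup F] [NormedSpace ℝ F] {f : A → P} {a : A}
    (h : Manifold.IsImmersionAtOfComplement F IA IP ∞ f a) (e : P ≃ₘ⟮IP, IP'⟯ P') :
    Manifold.IsImmersionAtOfComplement F IA IP' ∞ (e ∘ f) a := by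
  obtain ⟨χ, hχ, hsrc, hχx⟩ := exists_transportChart' L e h.codChart_mem_maximalAtlas
  refine Manifold.IsImmersionAtOfComplement.mk_of_charts (h.equiv.trans L) h.domChart χ
    h.mem_domChart_source ?_ h.domChart_mem_maximalAtlas hχ ?_ ?_
  · rw [hsrc]
    simpa using h.mem_codChart_source
  · intro x hx
    show (e ∘ f) x ∈ χ.source
    rw [hsrc]
    simpa using h.source_subset_preimage_source hx
  · intro u hu
    have := h.writtenInCharts hu
    simp only [Function.comp_apply, OpenPartialHomeomorph.extend_coe] at this ⊢
    rw [hχx]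
    simp only [Diffeomorph.symm_apply_apply, ContinuousLinearEquiv.trans_apply]
    rw [IP'.right_inv (by rw [IP'.range_eq_univ]; exact mem_univ _), ← this]

/-- **A smooth embedding followed by a diffeomorphism across isomorphic boundaryless models is a smooth
embedding.** [cite: Kosinski1993, Ch. VI §1] -/
theorem isSmoothEmbedding_diffeomorph_comp' [IP.Boundaryless] [IP'.Boundaryless]
    [IsManifold IP' ∞ P'] (L : EP ≃L[ℝ] EP') {f : A → P}
    (hf : Manifold.IsSmoothEmbedding IA IP ∞ f) (e : P ≃ₘ⟮IP, IP'⟯ P') :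
    Manifold.IsSmoothEmbedding IA IP' ∞ (e ∘ f) := by
  refine ⟨?_, e.toHomeomorph.isEmbedding.comp hf.isEmbedding⟩
  obtain ⟨F, _, _, h⟩ := hf.isImmersion
  exact ⟨F, inferInstance, inferInstance, fun x => isImmersionAtOfComplement_diffeomorph_comp' L (h x) e⟩

end Transport

section Gluing

variable {EA HA EB HB HP HP' : Type*} {EP EP' : Type u}
  [NormedAddCommGroup EA] [NormedSpace ℝ EA] [TopologicalSpace HA] {IA : ModelWithCorners ℝ EA HA}
  [NormedAddCommGroup EB] [NormedSpace ℝ EB] [TopologicalSpace HB] {IB : ModelWithCorners ℝ EB HB}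
  [NormedAddCommGroup EP] [NormedSpace ℝ EP] [TopologicalSpace HP] {IP : ModelWithCorners ℝ EP HP}
  [NormedAddCommGroup EP'] [NormedSpace ℝ EP'] [TopologicalSpace HP'] {IP' : ModelWithCorners ℝ EP' HP'}
  {A B P P' : Type*} [TopologicalSpace A] [ChartedSpace HA A] [TopologicalSpace B]
  [ChartedSpace HB B]
  [TopologicalSpace P] [ChartedSpace HP P] [TopologicalSpace P'] [ChartedSpace HP' P']

/-- **Transport of open gluings along a diffeomorphism across isomorphic boundaryless models** (post-compose the
gluing embeddings). [cite: Kosinski1993, Ch. VI §1, proof of Thm 1.1] -/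
theorem isOpenGluing_diffeomorph_comp' [IP.Boundaryless] [IP'.Boundaryless] [IsManifold IP' ∞ P']
    (L : EP ≃L[ℝ] EP') {R : A → B → Prop} (h : IsOpenGluing IA IB IP (P := P) R)
    (e : P ≃ₘ⟮IP, IP'⟯ P') : IsOpenGluing IA IB IP' (P := P') R := by
  obtain ⟨jA, jB, hA, hAo, hB, hBo, hU, hR⟩ := h
  refine ⟨e ∘ jA, e ∘ jB, isSmoothEmbedding_diffeomorph_comp' L hA e, ?_,
    isSmoothEmbedding_diffeomorph_comp' L hB e, ?_, ?_, fun a b => ?_⟩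
  · rw [range_comp]; exact e.toHomeomorph.isOpenMap _ hAo
  · rw [range_comp]; exact e.toHomeomorph.isOpenMap _ hBo
  · rw [range_comp, range_comp, ← image_union, hU, image_univ, e.toEquiv.range_eq_univ.symm]
    rfl
  · rw [← hR a b]
    exact e.injective.eq_iff

/-- **Transport of integral surgery descriptions** `IsIntegralSurgery IP P K m → IsIntegralSurgery IP' P' K m`
along a diffeomorphism `P ≃ₘ⟮IP, IP'⟯ P'` across isomorphic boundaryless models (e.g. `ℝ³`-charted `Y` versus
`S² × S¹` with its product model). [cite: GompfStipsicz1999, §5.3] -/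
theorem isIntegralSurgery_diffeomorph_comp' [IP.Boundaryless] [IP'.Boundaryless] [IsManifold IP' ∞ P']
    (L : EP ≃L[ℝ] EP') {K : Knot} {m : ℤ} (h : IsIntegralSurgery IP P K m) (e : P ≃ₘ⟮IP, IP'⟯ P') :
    IsIntegralSurgery IP' P' K m := by
  obtain ⟨ν, hν, hG⟩ := h
  exact ⟨ν, hν, isOpenGluing_diffeomorph_comp' L hG e⟩

end Gluing

/-! ### Property R in friend form, from the tree's named fact; the unknot cannot seed a witness -/

/-- **Property R, friend form, DERIVED from the tree's named fact** `isUnknot_of_isIntegralSurgery_zero`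
(Gabai 1987 Cor. 8.3, stated on `S² × S¹` with its product model): a knot sharing a `0`-surgery `Y` (any
`ℝ³`-charted `Y`) with the unknot is unknotted. Passage: `Y` is a manifold (`IsIntegralSurgery.isManifold`),
diffeomorphic to `S² × S¹` by uniqueness of surgery (`nonempty_diffeomorph_of_isIntegralSurgery_holds`, proved) and
`isIntegralSurgery_unknot_zero_holds` (proved); the surgery description of `Y` by `K'` is transported to `S² × S¹`
across the model change `ℝ³ ≃L ℝ² × ℝ¹` (`isIntegralSurgery_diffeomorph_comp'`). This discharges the spelled-out
hypothesis `PropertyRFriendForm` of the sibling crux work file (ZseCruxRasmussen §12) down to Gabai's theorem.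
[cite: GabaiJDG1987, Cor. 8.3] -/
theorem isUnknot_of_zeroSurgeryPair_unknot (hG : isUnknot_of_isIntegralSurgery_zero)
    {K' : Knot} {Y : Type} [TopologicalSpace Y] [ChartedSpace (EuclideanSpace ℝ (Fin 3)) Y]
    (hU : IsIntegralSurgery (𝓡 3) Y unknot 0) (hK' : IsIntegralSurgery (𝓡 3) Y K' 0) : K'.IsUnknot := by
  haveI : IsManifold (𝓡 3) ∞ Y := hU.isManifold
  obtain ⟨e⟩ := nonempty_diffeomorph_of_isIntegralSurgery_holds (IY := 𝓡 3) (Y := Y)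
    (SphereEmbedding.IsIsotopic.refl unknot) hU isIntegralSurgery_unknot_zero_holds
  have hfin : Module.finrank ℝ (EuclideanSpace ℝ (Fin 3)) =
      Module.finrank ℝ (EuclideanSpace ℝ (Fin 2) × EuclideanSpace ℝ (Fin 1)) := by
    simp [Module.finrank_prod]
  exact hG K' (isIntegralSurgery_diffeomorph_comp' (ContinuousLinearEquiv.ofFinrankEq hfin) hK' e)

/-- Mod Gabai's Property R (tree named fact), **a `0`-friend of an UNKNOTTED knot is unknotted** (transport
the surgery description along the isotopy to the unknot, `IsIntegralSurgery.of_isIsotopic_holds`, proved).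
[cite: GabaiJDG1987, Cor. 8.3] -/
theorem isUnknot_of_zeroSurgeryPair_isUnknot (hG : isUnknot_of_isIntegralSurgery_zero)
    {K K' : Knot} {Y : Type} [TopologicalSpace Y] [ChartedSpace (EuclideanSpace ℝ (Fin 3)) Y]
    (hK : K.IsUnknot) (h1 : IsIntegralSurgery (𝓡 3) Y K 0) (h2 : IsIntegralSurgery (𝓡 3) Y K' 0) :
    K'.IsUnknot :=
  isUnknot_of_zeroSurgeryPair_unknot hG (IsIntegralSurgery.of_isIsotopic_holds h1 hK) h2

/-- **No witness of the crux is seeded by the UNKNOT** (mod Gabai's Property R, tree named fact): the partner of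
the unknot is unknotted, hence smoothly slice (`Knot.IsUnknot.isSmoothlySlice` with the discharged isotopy
facts). [cite: GabaiJDG1987, Cor. 8.3] -/
theorem zseThesis_unknotSeed_false_of_gabai (hG : isUnknot_of_isIntegralSurgery_zero) :
    ¬ ∃ (K' : Knot) (Y : Type) (_ : TopologicalSpace Y) (_ : ChartedSpace (EuclideanSpace ℝ (Fin 3)) Y),
        IsIntegralSurgery (𝓡 3) Y unknot 0 ∧ IsIntegralSurgery (𝓡 3) Y K' 0 ∧ unknot.IsSmoothlySlice ∧
          ¬ K'.IsSmoothlySlice := by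
  rintro ⟨K', Y, _, _, hU, hK', -, h4⟩
  exact h4 ((isUnknot_of_zeroSurgeryPair_unknot hG hU hK').isSmoothlySlice
    Knot.IsSmoothlySlice.of_isIsotopic_holds)

/-- **The slice knot of a witness is KNOTTED** (mod Gabai's Property R): witnesses need a non-trivial slice
knot `K` (`6₁`, the square knot, …) — and by `WitnessShape` a partner outside its symmetry and concordance class.
[cite: GabaiJDG1987, Cor. 8.3] -/
theorem witness_seed_not_isUnknot_of_gabai (hG : isUnknot_of_isIntegralSurgery_zero)
    {K K' : Knot} {Y : Type} [TopologicalSpace Y] [ChartedSpace (EuclideanSpace ℝ (Fin 3)) Y]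
    (h1 : IsIntegralSurgery (𝓡 3) Y K 0) (h2 : IsIntegralSurgery (𝓡 3) Y K' 0) (h4 : ¬ K'.IsSmoothlySlice) :
    ¬ K.IsUnknot := fun hK ↦
  h4 ((isUnknot_of_zeroSurgeryPair_isUnknot hG hK h1 h2).isSmoothlySlice
    Knot.IsSmoothlySlice.of_isIsotopic_holds)

/-- The pair hypotheses with the unknot ARE satisfiable, together with a slice partner (`K' =` unknot,
`Y = S³₀(unknot)`): the two previous lemmas are not vacuous. [cite: GompfStipsicz1999, §5.3] -/
theorem unknotPair_exists :
    ∃ (K' : Knot) (Y : Type) (_ : TopologicalSpace Y) (_ : ChartedSpace (EuclideanSpace ℝ (Fin 3)) Y),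
      IsIntegralSurgery (𝓡 3) Y unknot 0 ∧ IsIntegralSurgery (𝓡 3) Y K' 0 ∧ K'.IsSmoothlySlice := by
  obtain ⟨Y, _, _, _, _, _, _, hY⟩ := exists_isIntegralSurgery_holds unknot 0
  exact ⟨unknot, Y, _, _, hY, hY, isSmoothlySlice_unknot⟩

end Summit.SmoothPoincare4.SmoothPoincare4.Theorems.ZseThesis.Negative

end
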